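import Summits.AtomisticToContinuum.HydrodynamicLimit.Theorems.MourreKoopmanChargesOneBodyCompletenessTorusMoments
import Summits.AtomisticToContinuum.HydrodynamicLimit.Theorems.AntiMazurCoboundariesCorrectorPressureDecayTangentBiasTorus
import Literature.MathematicalPhysics.KineticTheory.HardSphereGasFluctuations
import Literature.MathematicalPhysics.StatisticalMechanics.SpecificRelativeEntropy
import HarnessLib

/-!
# `OneBodyCompleteness` (crux stmt-AtomisticToContinuum-9583, route `MourreKoopmanCharges`), line `registered`:
# blown-up label forms of one-body cell statistics on the torus and the two partitions of unity

Helper file (`--supports stmt-AtomisticToContinuum-9583`) for the registered OPEN CORE #2 `stub_torusIdentificationUnit`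
of `Cruxes/OneBodyCompleteness/Lines/birth.lean` — the TORUS SIDE of its reduction to the two named inputs
`TwoTimeLocalLimitUnit` (I1) / `UniformTorusTwoTimeClustering` (I2) of `…IdentificationInputs.lean`.

For `N + 1` particles `z` on `𝕋³`, a hard-sphere flow `Φ` of diameter `ε = hsDiameter σ N`, the canonical law
`G = localGibbsLaw σ 1 0 θ N Φ`, continuous `χ` and `h`, and a time `t`, write `z' = Φ_t z`, `c_j = χ(x_j) h(v_j)` and
blow the configuration up by `ε⁻¹` around a base point `x ∈ 𝕋³` (`q_j(x) = ε⁻¹ reprSym(x_j - x)`, the positions of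
`blowUp ε x z`).  The LABEL FORM of the `χ`-weighted one-body cell statistic of the cell `C + ξ`, `C = [0,1)³`, is
`cellSum ε χ h x ξ z = Σ_j 1_C(q_j(x) - ξ) χ(x_j) h(v_j)`.  Two partitions of unity,

* over the base point: `∫_{𝕋³} 1_C(ε⁻¹ reprSym(x_j - x)) dx = ε³` once `3ε < 1/2` (torus averaging,
  `KiferCompactification.integral_mul_comp_blowUp`), whence `Σ_j c_j = ε⁻³ ∫ cellSum ε χ h x 0 z dx`;
* over the offset: `∫_{ℝ³} 1_C(q - ξ) dξ = 1`, whence `Σ_i c'_i = ∫ cellSum ε χ h x ξ z' dξ` for every `x`,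

are proved here together with the unit mass of the blown-up cell indicator on `𝕋³ × ℝ³`
(`integrable_indicator_bpos_sub_prod`); Fubini and the EXACT DECOMPOSITION
`(N+1) · E_G[A(z') A(z)] = σ⁻³ ∫_{𝕋³ × ℝ³} E_G[cellSum ε χ h x ξ z' · cellSum ε χ h x 0 z] d(x, ξ)` follow in the
companion file `…IdentificationDecomposition.lean`.  On the hard-sphere domain (distinct positions) the label form IS
the linear statistic of the blown-up configuration with the slowly varying weight `y ↦ χ(x + proj(ε(y + ξ)))`
(`cellSum_eq_mul_linStat_blowUp`, `linStat_blowUp_eq_sum`), the form in which (I1), (I2) are stated.  The label form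
is a SECTION VARIABLE `cs` pinned down by the hypothesis `hcs` (no definition is introduced); the reduction instantiates
it with the explicit sum.

References: S. Olla, S. R. S. Varadhan, H.-T. Yau, Comm. Math. Phys. 155 (1993) §3–4 (blow-up around a uniformly
distributed base point); H. Spohn, *Large Scale Dynamics of Interacting Particles* (1991), Part I §7.1.
-/

noncomputable section

namespace Summit.AtomisticToContinuum.HydrodynamicLimit.Theorems.MourreKoopmanChargesOneBodyCompleteness

open MeasureTheory ProbabilityTheory Filter Topology Set Function
open scoped ENNReal InnerProductSpace BigOperators
open Literature.Analysis.FluidPDE Literature.MathematicalPhysics.KineticTheory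
open Literature.Analysis.FunctionSpaces (PointConfig)
open Literature.Analysis.FunctionSpaces.Torus (proj continuous_proj)
open Literature.Analysis.FluidPDE.Torus (reprSym measurable_reprSym proj_reprSym)
open Summit.AtomisticToContinuum.HydrodynamicLimit.Theorems.KiferCompactification (integral_mul_comp_blowUp)
open Summit.AtomisticToContinuum.HydrodynamicLimit.Theorems.MourreKoopmanChargesIdealGasNoDecay
  (exists_bound_of_continuous)

/-! ### Blown-up positions, label sums over blown-up configurations, the two partitions of unity -/

/-- The position of a blown-up particle: `(blowUpPoint ε x (q, v)).1 = ε⁻¹ reprSym(q - x)` (`bpos ε x q` in the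
docstrings below). [folklore] -/
@[simp] theorem blowUpPoint_fst (ε : ℝ) (x : T3) (p : T3 × V3) : (blowUpPoint ε x p).1 = ε⁻¹ • reprSym (p.1 - x) := rfl

/-- The velocity of a blown-up particle is unchanged. [folklore] -/
@[simp] theorem blowUpPoint_snd (ε : ℝ) (x : T3) (p : T3 × V3) : (blowUpPoint ε x p).2 = p.2 := rfl

/-- Blowing down recovers the torus point: `x + proj(ε · ε⁻¹ • reprSym (q - x)) = q`. [folklore] -/
theorem add_proj_smul_bpos {ε : ℝ} (hε : ε ≠ 0) (x q : T3) : x + proj (ε • ε⁻¹ • reprSym (q - x)) = q := by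
  rw [smul_smul, mul_inv_cancel₀ hε, one_smul, proj_reprSym, add_sub_cancel]

/-- `bpos` is jointly measurable in the base point and the torus point. [folklore] -/
theorem measurable_bpos (ε : ℝ) : Measurable fun p : T3 × T3 => ε⁻¹ • reprSym (p.2 - p.1) := by
  have h1 : Measurable fun p : T3 × T3 => p.2 - p.1 := measurable_snd.sub measurable_fst
  have h2 : Measurable fun p : T3 × T3 => reprSym (p.2 - p.1) := measurable_reprSym.comp h1
  have h3 : Measurable fun p : T3 × T3 => ε⁻¹ • reprSym (p.2 - p.1) := h2.const_smul ε⁻¹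
  exact h3

/-- On the hard-sphere domain of positive diameter the positions are pairwise distinct. [folklore] -/
theorem pos_injective_of_mem_hardSphereDomain {n : ℕ} {ε : ℝ} (hε : 0 < ε) {z : Config n (Fin 3) T3}
    (hz : z ∈ hardSphereDomain (Torus.geometry (Fin 3)) n ε) : Injective fun j => (z j).1 := by
  intro i j hij
  by_contra hne
  have h := hz i j hne
  simp only [Torus.geometry_sepVec] at h
  rw [show (z i).1 = (z j).1 from hij, sub_self, Torus.reprSym_zero, norm_zero] at h
  exact absurd h (not_le.2 hε)

/-- Blown-up particles of a configuration with distinct positions are distinct (`ε ≠ 0`). [folklore] -/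
theorem blowUpPoint_injective {n : ℕ} {ε : ℝ} (hε : ε ≠ 0) (x : T3) {z : Config n (Fin 3) T3}
    (hz : Injective fun j => (z j).1) : Injective fun j => blowUpPoint ε x (z j) := by
  intro i j hij
  have h1 : ε⁻¹ • reprSym ((z i).1 - x) = ε⁻¹ • reprSym ((z j).1 - x) := by
    have := congrArg Prod.fst hij
    simpa only [blowUpPoint_fst] using this
  have h2 : x + proj (ε • ε⁻¹ • reprSym ((z i).1 - x)) = x + proj (ε • ε⁻¹ • reprSym ((z j).1 - x)) := by rw [h1]
  rw [add_proj_smul_bpos hε, add_proj_smul_bpos hε] at h2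
  exact hz h2

/-- **Linear statistics of the blown-up configuration are label sums** when the positions are distinct:
`Σ_{p ∈ blowUp ε x z} f(p) = Σ_j f(blowUpPoint ε x z_j)`. [folklore] -/
theorem linStat_blowUp_eq_sum {n : ℕ} {ε : ℝ} (hε : ε ≠ 0) (x : T3) {z : Config n (Fin 3) T3}
    (hz : Injective fun j => (z j).1) (f : V3 × V3 → ℝ) :
    linStat f (blowUp ε x z) = ∑ j, f (blowUpPoint ε x (z j)) := by
  rw [linStat, PointConfig.coe_eq_carrier, show (blowUp ε x z).carrier = Set.range fun j => blowUpPoint ε x (z j)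
    from rfl, finsum_mem_range (blowUpPoint_injective hε x hz), finsum_eq_sum_of_fintype]

/-- **Partition of unity over the base point**: `∫_{𝕋³} 1_C(ε⁻¹ • reprSym (q - x)) dx = ε³` for `0 < ε`, `3ε < 1/2` (torus
averaging of the blown-up indicator of the unit cell, which lies in the ball of radius `3`). [folklore] -/
theorem integral_indicator_bpos {ε : ℝ} (hε : 0 < ε) (hε3 : ε * 3 < 1 / 2) (q : T3) :
    ∫ x : T3, (unitCell : Set V3).indicator (fun _ => (1 : ℝ)) (ε⁻¹ • reprSym (q - x)) = ε ^ 3 := by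
  have hψ : Measurable ((unitCell : Set V3).indicator fun _ => (1 : ℝ)) :=
    measurable_const.indicator measurableSet_unitCell
  have hψr : ∀ y : V3, 3 < ‖y‖ → (unitCell : Set V3).indicator (fun _ => (1 : ℝ)) y = 0 := fun y hy =>
    Set.indicator_of_notMem (fun hm => absurd (norm_le_of_mem_unitCell hm) (not_le.2 hy)) _
  have key := integral_mul_comp_blowUp (k := fun _ => (1 : ℝ)) measurable_const hψ hε hε3 hψr q
  simp only [one_mul] at key
  rw [show (fun x : T3 => (unitCell : Set V3).indicator (fun _ => (1 : ℝ)) (ε⁻¹ • reprSym (q - x))) =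
      fun x : T3 => (unitCell : Set V3).indicator (fun _ => (1 : ℝ)) (ε⁻¹ • reprSym (q - x)) from rfl, key,
    integral_indicator_const _ measurableSet_unitCell, measureReal_def,
    show volume (unitCell : Set V3) = 1 from Literature.MathematicalPhysics.StatisticalMechanics.volume_unitCube]
  simp

/-- **Partition of unity over the offset**: `∫_{ℝ³} 1_C(q - ξ) dξ = 1`. [folklore] -/
theorem integral_indicator_sub (q : V3) :
    ∫ ξ : V3, (unitCell : Set V3).indicator (fun _ => (1 : ℝ)) (q - ξ) = 1 := by
  rw [integral_sub_left_eq_self (fun y : V3 => (unitCell : Set V3).indicator (fun _ => (1 : ℝ)) y) volume q,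
    integral_indicator_const _ measurableSet_unitCell, measureReal_def,
    show volume (unitCell : Set V3) = 1 from Literature.MathematicalPhysics.StatisticalMechanics.volume_unitCube]
  simp

/-- The offset indicator `ξ ↦ 1_C(q - ξ)` is integrable on `ℝ³` (indicator of a translate of `-C`). [folklore] -/
theorem integrable_indicator_sub (q : V3) :
    Integrable (fun ξ : V3 => (unitCell : Set V3).indicator (fun _ => (1 : ℝ)) (q - ξ)) := by
  have e : (fun ξ : V3 => (unitCell : Set V3).indicator (fun _ => (1 : ℝ)) (q - ξ)) =
      ((fun ξ : V3 => q - ξ) ⁻¹' (unitCell : Set V3)).indicator fun _ => (1 : ℝ) := by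
    funext ξ
    exact (Set.indicator_comp_right (fun ξ : V3 => q - ξ) (g := fun _ => (1 : ℝ))).symm
  have hmeas : Measurable fun ξ : V3 => q - ξ := measurable_const.sub measurable_id
  rw [e, integrable_indicator_iff (measurableSet_unitCell.preimage hmeas)]
  refine integrableOn_const ?_
  rw [← Measure.map_apply hmeas measurableSet_unitCell,
    (Measure.measurePreserving_sub_left volume q).map_eq,
    show volume (unitCell : Set V3) = 1 from Literature.MathematicalPhysics.StatisticalMechanics.volume_unitCube]
  exact ENNReal.one_ne_top

/-- The base-point indicator `x ↦ 1_C(ε⁻¹ • reprSym (q - x) - ξ)` is integrable on `𝕋³` (bounded measurable, finite measure).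
[folklore] -/
theorem integrable_indicator_bpos (ε : ℝ) (q : T3) (ξ : V3) :
    Integrable (fun x : T3 => (unitCell : Set V3).indicator (fun _ => (1 : ℝ)) (ε⁻¹ • reprSym (q - x) - ξ)) := by
  have hm : Measurable fun x : T3 => (unitCell : Set V3).indicator (fun _ => (1 : ℝ)) (ε⁻¹ • reprSym (q - x) - ξ) :=
    (measurable_const.indicator measurableSet_unitCell).comp
      (((measurable_bpos ε).comp (measurable_id.prodMk measurable_const)).sub measurable_const)
  refine Integrable.of_bound hm.aestronglyMeasurable 1 (ae_of_all _ fun x => ?_)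
  by_cases h : ε⁻¹ • reprSym (q - x) - ξ ∈ (unitCell : Set V3)
  · simp [Set.indicator_of_mem h]
  · simp [Set.indicator_of_notMem h]

/-- The blown-up cell indicator `(x, ξ) ↦ 1_C(ε⁻¹ • reprSym (q - x) - ξ)` is integrable on `𝕋³ × ℝ³` with integral `1`
(sections in `x`: the offset partition of unity). [folklore] -/
theorem integrable_indicator_bpos_sub_prod (ε : ℝ) (q : T3) :
    Integrable (fun p : T3 × V3 => (unitCell : Set V3).indicator (fun _ => (1 : ℝ)) (ε⁻¹ • reprSym (q - p.1) - p.2))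
      ((volume : Measure T3).prod (volume : Measure V3)) ∧
    ∫ p : T3 × V3, (unitCell : Set V3).indicator (fun _ => (1 : ℝ)) (ε⁻¹ • reprSym (q - p.1) - p.2)
      ∂((volume : Measure T3).prod (volume : Measure V3)) = 1 := by
  have hm : Measurable fun p : T3 × V3 => (unitCell : Set V3).indicator (fun _ => (1 : ℝ)) (ε⁻¹ • reprSym (q - p.1) - p.2) :=
    (measurable_const.indicator measurableSet_unitCell).comp
      (((measurable_bpos ε).comp (measurable_fst.prodMk measurable_const)).sub measurable_snd)
  have hnorm : (fun x : T3 => ∫ ξ : V3, ‖(unitCell : Set V3).indicator (fun _ => (1 : ℝ)) (ε⁻¹ • reprSym (q - x) - ξ)‖) =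
      fun _ => (1 : ℝ) := by
    funext x
    have e : (fun ξ : V3 => ‖(unitCell : Set V3).indicator (fun _ => (1 : ℝ)) (ε⁻¹ • reprSym (q - x) - ξ)‖) =
        fun ξ : V3 => (unitCell : Set V3).indicator (fun _ => (1 : ℝ)) (ε⁻¹ • reprSym (q - x) - ξ) := by
      funext ξ
      rw [norm_indicator_eq_indicator_norm, norm_one]
    rw [e]
    exact integral_indicator_sub _
  have hint : Integrable (fun p : T3 × V3 => (unitCell : Set V3).indicator (fun _ => (1 : ℝ)) (ε⁻¹ • reprSym (q - p.1) - p.2))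
      ((volume : Measure T3).prod (volume : Measure V3)) := by
    refine (integrable_prod_iff hm.aestronglyMeasurable).2 ⟨ae_of_all _ fun x => ?_, ?_⟩
    · have h1 := integrable_indicator_sub (ε⁻¹ • reprSym (q - x))
      exact h1
    · rw [hnorm]
      exact integrable_const _
  refine ⟨hint, ?_⟩
  rw [integral_prod _ hint]
  have e2 : (fun x : T3 => ∫ ξ : V3, (unitCell : Set V3).indicator (fun _ => (1 : ℝ)) (ε⁻¹ • reprSym (q - (x, ξ).1) - (x, ξ).2)) =
      fun _ => (1 : ℝ) := by
    funext x
    exact integral_indicator_sub (ε⁻¹ • reprSym (q - x))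
  rw [e2, integral_const, smul_eq_mul, mul_one, probReal_univ]

/-! ### The label form of the weighted cell statistic (a section variable `cs` fixed by `hcs`; no definition) -/

section LabelForm

variable (cs : ∀ {n : ℕ}, ℝ → (T3 → ℝ) → (V3 → ℝ) → T3 → V3 → Config n (Fin 3) T3 → ℝ)
  (hcs : ∀ {n : ℕ} (ε : ℝ) (χ : T3 → ℝ) (h : V3 → ℝ) (x : T3) (ξ : V3) (z : Config n (Fin 3) T3),
    cs ε χ h x ξ z = ∑ j, (unitCell : Set V3).indicator (fun _ => (1 : ℝ)) (ε⁻¹ • reprSym ((z j).1 - x) - ξ) *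
      (χ (z j).1 * h (z j).2))
include hcs

/-- The label form is linear in the weight: `cellSum ε χ h - c · cs ε 1 h = cellSum ε (χ - c) h`. [folklore] -/
theorem cellSum_sub_const_mul {n : ℕ} (ε : ℝ) (χ : T3 → ℝ) (h : V3 → ℝ) (c : ℝ) (x : T3) (ξ : V3)
    (z : Config n (Fin 3) T3) :
    cs ε χ h x ξ z - c * cs ε (fun _ => (1 : ℝ)) h x ξ z = cs ε (fun y => χ y - c) h x ξ z := by
  simp only [hcs, Finset.mul_sum, ← Finset.sum_sub_distrib]
  refine Finset.sum_congr rfl fun j _ => ?_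
  ring

/-- Crude bound on the label form: `|cs ε χ h x ξ z| ≤ B Σ_j 1_C(ε⁻¹ • reprSym (x_j - x) - ξ) |h(v_j)|` if `|χ| ≤ B`.
[folklore] -/
theorem abs_cellSum_le {n : ℕ} (ε : ℝ) {χ : T3 → ℝ} {B : ℝ} (hB : ∀ y, |χ y| ≤ B) (h : V3 → ℝ) (x : T3) (ξ : V3)
    (z : Config n (Fin 3) T3) :
    |cs ε χ h x ξ z| ≤
      B * ∑ j, (unitCell : Set V3).indicator (fun _ => (1 : ℝ)) (ε⁻¹ • reprSym ((z j).1 - x) - ξ) * |h (z j).2| := by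
  rw [hcs, Finset.mul_sum]
  refine (Finset.abs_sum_le_sum_abs _ _).trans (Finset.sum_le_sum fun j _ => ?_)
  have hind : 0 ≤ (unitCell : Set V3).indicator (fun _ => (1 : ℝ)) (ε⁻¹ • reprSym ((z j).1 - x) - ξ) ∧
      (unitCell : Set V3).indicator (fun _ => (1 : ℝ)) (ε⁻¹ • reprSym ((z j).1 - x) - ξ) ≤ 1 := by
    by_cases hm : ε⁻¹ • reprSym ((z j).1 - x) - ξ ∈ (unitCell : Set V3)
    · simp [Set.indicator_of_mem hm]
    · simp [Set.indicator_of_notMem hm]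
  rw [abs_mul, abs_mul, abs_of_nonneg hind.1]
  calc (unitCell : Set V3).indicator (fun _ => (1 : ℝ)) (ε⁻¹ • reprSym ((z j).1 - x) - ξ) * (|χ (z j).1| * |h (z j).2|)
      ≤ (unitCell : Set V3).indicator (fun _ => (1 : ℝ)) (ε⁻¹ • reprSym ((z j).1 - x) - ξ) * (B * |h (z j).2|) := by
        gcongr
        · exact hind.1
        · exact hB _
    _ = B * ((unitCell : Set V3).indicator (fun _ => (1 : ℝ)) (ε⁻¹ • reprSym ((z j).1 - x) - ξ) * |h (z j).2|) := by ring

/-- The cruder bound without the cell indicator: `|cs ε χ h x ξ z| ≤ B Σ_j |h(v_j)|`. [folklore] -/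
theorem abs_cellSum_le' {n : ℕ} (ε : ℝ) {χ : T3 → ℝ} {B : ℝ} (hB : ∀ y, |χ y| ≤ B) (h : V3 → ℝ) (x : T3) (ξ : V3)
    (z : Config n (Fin 3) T3) : |cs ε χ h x ξ z| ≤ B * ∑ j, |h (z j).2| := by
  have hB0 : 0 ≤ B := (abs_nonneg _).trans (hB 0)
  refine (abs_cellSum_le cs hcs ε hB h x ξ z).trans (mul_le_mul_of_nonneg_left (Finset.sum_le_sum fun j _ => ?_) hB0)
  by_cases hm : ε⁻¹ • reprSym ((z j).1 - x) - ξ ∈ (unitCell : Set V3)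
  · simp [Set.indicator_of_mem hm]
  · simp [Set.indicator_of_notMem hm]

/-- **Joint measurability of the label form** along measurable families of base points, offsets and configurations.
[folklore] -/
theorem measurable_cellSum {α : Type*} [MeasurableSpace α] {n : ℕ} (ε : ℝ) {χ : T3 → ℝ} (hχ : Measurable χ)
    {h : V3 → ℝ} (hh : Measurable h) {fx : α → T3} (hfx : Measurable fx) {fξ : α → V3} (hfξ : Measurable fξ)
    {g : α → Config n (Fin 3) T3} (hg : Measurable g) :
    Measurable fun a => cs ε χ h (fx a) (fξ a) (g a) := by
  simp only [hcs]
  refine Finset.measurable_sum _ fun j _ => ?_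
  have hzj : Measurable fun a => g a j := (measurable_pi_apply j).comp hg
  have hq : Measurable fun a => ε⁻¹ • reprSym ((g a j).1 - (fx a)) - fξ a :=
    ((measurable_bpos ε).comp (hfx.prodMk hzj.fst)).sub hfξ
  exact ((measurable_const.indicator measurableSet_unitCell).comp hq).mul
    ((hχ.comp hzj.fst).mul (hh.comp hzj.snd))

/-- **The label form with unit weight is the cell statistic of the cell `C + ξ` of the blown-up configuration**
(distinct positions). [folklore] -/
theorem linStat_indicator_blowUp_eq_cellSum {n : ℕ} {ε : ℝ} (hε : ε ≠ 0) (h : V3 → ℝ) (x : T3) (ξ : V3)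
    {z : Config n (Fin 3) T3} (hz : Injective fun j => (z j).1) :
    linStat (fun p => (unitCell : Set V3).indicator (fun _ => (1 : ℝ)) (p.1 - ξ) * h p.2) (blowUp ε x z) =
      cs ε (fun _ => (1 : ℝ)) h x ξ z := by
  rw [linStat_blowUp_eq_sum hε x hz, hcs]
  simp only [blowUpPoint_fst, blowUpPoint_snd, one_mul]

/-- **The weighted label form is a weighted cell statistic of the blown-up configuration** with the slowly varying
weight `y ↦ W(x + proj(ε(y + ξ)))/B` inside the cell (distinct positions, `B ≠ 0`): the form in which (I2) is stated.
[folklore] -/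
theorem cellSum_eq_mul_linStat_blowUp {n : ℕ} {ε : ℝ} (hε : ε ≠ 0) (W : T3 → ℝ) {B : ℝ} (hB : B ≠ 0)
    (h : V3 → ℝ) (x : T3) (ξ : V3) {z : Config n (Fin 3) T3} (hz : Injective fun j => (z j).1) :
    cs ε W h x ξ z = B * linStat (fun p => (unitCell : Set V3).indicator
      (fun y => W (x + proj (ε • (y + ξ))) / B) (p.1 - ξ) * h p.2) (blowUp ε x z) := by
  rw [linStat_blowUp_eq_sum hε x hz, hcs, Finset.mul_sum]
  refine Finset.sum_congr rfl fun j _ => ?_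
  simp only [blowUpPoint_fst, blowUpPoint_snd]
  by_cases hm : ε⁻¹ • reprSym ((z j).1 - x) - ξ ∈ (unitCell : Set V3)
  · rw [Set.indicator_of_mem hm, Set.indicator_of_mem hm, sub_add_cancel, add_proj_smul_bpos hε]
    field_simp
  · rw [Set.indicator_of_notMem hm, Set.indicator_of_notMem hm]
    ring

/-- **The `j`-sum through the base-point partition of unity**: `ε³ Σ_j χ(x_j) h(v_j) = ∫_{𝕋³} cs ε χ h x 0 z dx`.
[folklore] -/
theorem integral_cellSum_zero {n : ℕ} {ε : ℝ} (hε : 0 < ε) (hε3 : ε * 3 < 1 / 2) (χ : T3 → ℝ) (h : V3 → ℝ)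
    (z : Config n (Fin 3) T3) :
    ∫ x : T3, cs ε χ h x 0 z = ε ^ 3 * ∑ j, χ (z j).1 * h (z j).2 := by
  simp only [hcs, sub_zero]
  rw [integral_finsetSum _ fun j _ => ((integrable_indicator_bpos ε (z j).1 0).congr
    (ae_of_all _ fun x => by simp only [sub_zero])).mul_const _, Finset.mul_sum]
  refine Finset.sum_congr rfl fun j _ => ?_
  rw [integral_mul_const, integral_indicator_bpos hε hε3]

/-- **The `i`-sum through the offset partition of unity**: `Σ_i χ(x'_i) h(v'_i) = ∫_{ℝ³} cs ε χ h x ξ z' dξ`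
for every base point. [folklore] -/
theorem integral_cellSum_offset {n : ℕ} (ε : ℝ) (χ : T3 → ℝ) (h : V3 → ℝ) (x : T3) (z : Config n (Fin 3) T3) :
    ∫ ξ : V3, cs ε χ h x ξ z = ∑ j, χ (z j).1 * h (z j).2 := by
  simp only [hcs]
  rw [integral_finsetSum _ fun j _ => (integrable_indicator_sub (ε⁻¹ • reprSym ((z j).1 - x))).mul_const _]
  refine Finset.sum_congr rfl fun j _ => ?_
  rw [integral_mul_const, integral_indicator_sub, one_mul]


/-- The weighted label form of the cell `C` (offset `0`) as a weighted cell statistic of the blown-up configuration,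
in the form of the time-zero factor of (I2). [folklore] -/
theorem cellSum_zero_eq_mul_linStat_blowUp {n : ℕ} {ε : ℝ} (hε : ε ≠ 0) (W : T3 → ℝ) {B : ℝ} (hB : B ≠ 0)
    (h : V3 → ℝ) (x : T3) {z : Config n (Fin 3) T3} (hz : Injective fun j => (z j).1) :
    cs ε W h x 0 z = B * linStat (fun p => (unitCell : Set V3).indicator
      (fun y => W (x + proj (ε • y)) / B) p.1 * h p.2) (blowUp ε x z) := by
  rw [cellSum_eq_mul_linStat_blowUp cs hcs hε W hB h x 0 hz]
  simp only [add_zero, sub_zero]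

/-- The unit-weight label form of the cell `C` is the cell observable of the blown-up configuration, in the form of
the time-zero factor of (I1). [folklore] -/
theorem linStat_indicator_blowUp_eq_cellSum_zero {n : ℕ} {ε : ℝ} (hε : ε ≠ 0) (h : V3 → ℝ) (x : T3)
    {z : Config n (Fin 3) T3} (hz : Injective fun j => (z j).1) :
    linStat (fun p => (unitCell : Set V3).indicator (fun _ => (1 : ℝ)) p.1 * h p.2) (blowUp ε x z) =
      cs ε (fun _ => (1 : ℝ)) h x 0 z := by
  rw [← linStat_indicator_blowUp_eq_cellSum cs hcs hε h x 0 hz]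
  simp only [sub_zero]

end LabelForm

end Summit.AtomisticToContinuum.HydrodynamicLimit.Theorems.MourreKoopmanChargesOneBodyCompleteness

end
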